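import Literature.MathematicalPhysics.KineticTheory.LangevinChainEnergyIdentity
import Literature.MathematicalPhysics.KineticTheory.LangevinChainLyapunov
import Literature.MathematicalPhysics.KineticTheory.LangevinChainScalingLimit
import HarnessLib

/-!
# The undriven damped pinned chain relaxes to its equilibrium (LaSalle's invariance principle)

Trunk T-KINETIC (Literature/MathematicalPhysics/KineticTheory). Provefact unit for the named fact
`CuneoEckmannHairerReyBellet2018_thm213` (`LangevinSemigroup.lean`): the deterministic half of the
irreducibility statement of Cuneo–Eckmann–Hairer–Rey-Bellet 2018, Prop. 3.3 ("the control system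
… where the noises have been replaced with smooth control functions" — here the ZERO control), for
the pinned anharmonic chain `pinnedChain ω₂ lam β γ` (`U = ω₂q²/2 + lam q⁴/4`, `V = r²/2 + βr⁴/4`,
friction `γ` at both ends).

For the flow `φ_t(x) = chainFlow x 0 t` of the chain driven by the zero noise path (the damped
Hamiltonian system `q̇ = p`, `ṗ_i = -∂_iΦ(q) - γ w_i p_i`, `w_i = [i=0] + [i=N-1]`):

* `pinnedChain_hamiltonian_freeFlow_eq` — `H(φ_t x) = H(x) - Γ_t(x)` with the dissipation
  `Γ_t = γ∫₀ᵗ ∑ w_i p_i²` (the energy identity of `LangevinChainEnergyIdentity.lean` at `η = 0`);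
* `pinnedChain_eq_zero_of_momentum_last_eq_zero` — **rigidity**: if along `φ(w)` the momentum of
  the last site vanishes identically, then `w = 0` (peel the chain from the right through the
  integral equation: `q_{N-1}` is constant, so `V'(q_{N-1} - q_{N-2})` is constant, so `q_{N-2}` is
  constant since `V' = r + βr³` is injective, …; the resulting equilibrium has
  `∑ q_i ∂_iΦ(q) ≥ ω₂|q|² = 0`);
* `pinnedChain_tendsto_freeFlow_zero` — **LaSalle**: `φ_t(x) → 0` as `t → ∞` for every `x`
  (`ω₂, β, γ > 0`, `lam ≥ 0`, `N ≥ 1`): the orbit stays in the compact set `{H ≤ H(x)}`; at a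
  cluster point `w` the energy is constant along `φ(w)` (continuity of the flow in the initial
  condition and the cocycle property), so the dissipation vanishes, so `p_{N-1} ≡ 0` along `φ(w)`,
  so `w = 0` by rigidity.

These feed the pointed irreducibility `P_t(z, G) > 0` (`G ∋ 0` open, `t` large) of the transition
probabilities of the pinned chain (sequel), replacing hypothesis `h33` of
`LangevinChainSmallSets.lean`.

## References

* N. Cuneo, J.-P. Eckmann, M. Hairer, L. Rey-Bellet, *Non-equilibrium steady states for networks
  of oscillators*, Electron. J. Probab. 23 (2018) no. 55 (arXiv:1712.09413), Prop. 3.3 and §4.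
* J. P. LaSalle, *Some extensions of Liapunov's second method*, IRE Trans. Circuit Theory 7
  (1960) 520–527 (the invariance principle). [folklore]
-/

noncomputable section

open MeasureTheory Filter Topology Set Metric
open scoped NNReal

namespace Literature.MathematicalPhysics.KineticTheory.HeatConduction

open OscillatorChain

/-! ### A calculus lemma -/

/-- **A continuous function with vanishing primitive vanishes**: if `∫₀ᵗ g = 0` for all `t ≥ 0`
and `g` is continuous then `g = 0` on `[0, ∞)` (differentiate the primitive on `(0, ∞)`, pass to
the closure). [folklore] -/
theorem eq_zero_of_intervalIntegral_eq_zero {g : ℝ → ℝ} (hg : Continuous g)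
    (h : ∀ t, 0 ≤ t → ∫ s in (0 : ℝ)..t, g s = 0) : ∀ t, 0 ≤ t → g t = 0 := by
  -- on `(0, ∞)`: the primitive is locally zero, its derivative is `g`
  have hpos : ∀ t, 0 < t → g t = 0 := by
    intro t ht
    have hderiv : HasDerivAt (fun u => ∫ s in (0 : ℝ)..u, g s) (g t) t :=
      intervalIntegral.integral_hasDerivAt_right (hg.intervalIntegrable 0 t)
        (hg.stronglyMeasurableAtFilter _ _) hg.continuousAt
    have hzero : (fun u => ∫ s in (0 : ℝ)..u, g s) =ᶠ[𝓝 t] fun _ => (0 : ℝ) := by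
      filter_upwards [Ioi_mem_nhds ht] with u hu
      exact h u (le_of_lt hu)
    have hderiv0 : HasDerivAt (fun u => ∫ s in (0 : ℝ)..u, g s) 0 t :=
      (hasDerivAt_const t (0 : ℝ)).congr_of_eventuallyEq hzero
    exact hderiv.unique hderiv0
  -- at `0` by continuity
  intro t ht
  rcases lt_or_eq_of_le ht with ht' | rfl
  · exact hpos t ht'
  · have hclosed : IsClosed {t : ℝ | g t = 0} := isClosed_eq hg continuous_const
    have hsub : Ioi (0 : ℝ) ⊆ {t : ℝ | g t = 0} := fun t ht => hpos t ht
    have h0 : (0 : ℝ) ∈ closure (Ioi (0 : ℝ)) := by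
      rw [closure_Ioi]
      exact self_mem_Ici
    exact hclosed.closure_subset_iff.2 hsub h0

/-! ### The undriven flow of the pinned chain -/

section Free

variable {ω₂ lam β γ : ℝ} (hω : 0 < ω₂) (hl : 0 ≤ lam) (hβ : 0 ≤ β) (hγ : 0 ≤ γ) (N : ℕ)
include hω hl hβ hγ

omit hω hl hβ hγ in
/-- The undriven flow starts at `x`: `φ_0(x) = x`. [folklore] -/
theorem pinnedChain_freeFlow_zero (x : PhaseSpace N) :
    (pinnedChain ω₂ lam β γ).chainFlow N x 0 0 = x := by
  rw [pinnedChain_chainFlow_of_nonpos ω₂ lam β γ N x (η := 0) continuous_zero le_rfl]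
  simp

omit hω hl hβ hγ in
/-- For `t ≤ 0` the undriven flow is clamped at `x`. [folklore] -/
theorem pinnedChain_freeFlow_of_nonpos (x : PhaseSpace N) {t : ℝ} (ht : t ≤ 0) :
    (pinnedChain ω₂ lam β γ).chainFlow N x 0 t = x := by
  rw [pinnedChain_chainFlow_of_nonpos ω₂ lam β γ N x (η := 0) continuous_zero ht]
  simp

/-- **The cocycle property of the undriven flow**: `φ_{s+t} = φ_t ∘ φ_s` for `s, t ≥ 0`.
[folklore] -/
theorem pinnedChain_freeFlow_add (x : PhaseSpace N) {s t : ℝ} (hs : 0 ≤ s) (ht : 0 ≤ t) :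
    (pinnedChain ω₂ lam β γ).chainFlow N x 0 (s + t) =
      (pinnedChain ω₂ lam β γ).chainFlow N ((pinnedChain ω₂ lam β γ).chainFlow N x 0 s) 0 t := by
  have h := pinnedChain_chainFlow_add hω hl hβ hγ N x (η := 0) continuous_zero hs ht
  have e : (fun r : ℝ => (0 : ℝ → Fin N → ℝ) (s + r) - (0 : ℝ → Fin N → ℝ) s) = 0 := by
    funext r; simp
  rw [e] at h
  exact h

/-- The undriven flow solves the integral equation `z(t) = x + ∫₀ᵗ Y(z(s)) ds`, `t ≥ 0`.
[folklore] -/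
theorem pinnedChain_freeFlow_eq_integral (x : PhaseSpace N) {t : ℝ} (ht : 0 ≤ t) :
    (pinnedChain ω₂ lam β γ).chainFlow N x 0 t =
      x + ∫ s in (0 : ℝ)..t, (pinnedChain ω₂ lam β γ).drift N ((pinnedChain ω₂ lam β γ).chainFlow N x 0 s) := by
  have h := pinnedChain_isIntegralSolutionOn_chainFlow hω hl hβ hγ N x (η := 0) continuous_zero t t
    ⟨ht, le_rfl⟩
  rw [h]
  simp [OscillatorChain.forcing]

omit hω hl hβ hγ in
/-- The work of the zero noise path vanishes. [folklore] -/
theorem pinnedChain_noiseWork_zero (x : PhaseSpace N) (t : ℝ) :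
    (pinnedChain ω₂ lam β γ).noiseWork N x 0 t = 0 := by
  simp [OscillatorChain.noiseWork]

/-- **Energy balance of the undriven flow**: `H(φ_t x) = H(x) - Γ_t(x)` for `t ≥ 0`, with the
dissipation `Γ_t(x) = γ ∫₀ᵗ ∑_i w_i p_i(s)² ds` (`LangevinChainEnergyIdentity.lean` at `η = 0`).
[cite: CuneoEckmannHairerReyBellet2018, §5 eq. (5.2)] -/
theorem pinnedChain_hamiltonian_freeFlow_eq (x : PhaseSpace N) {t : ℝ} (ht : 0 ≤ t) :
    (pinnedChain ω₂ lam β γ).hamiltonian N ((pinnedChain ω₂ lam β γ).chainFlow N x 0 t) =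
      (pinnedChain ω₂ lam β γ).hamiltonian N x - (pinnedChain ω₂ lam β γ).dissipation N x 0 t := by
  rw [pinnedChain_hamiltonian_chainFlow_eq hω hl hβ hγ N x (η := 0) continuous_zero ht,
    pinnedChain_noiseWork_zero N x t, add_zero]

/-- The energy does not increase along the undriven flow: `H(φ_t x) ≤ H(x)` (all `t`). [folklore] -/
theorem pinnedChain_hamiltonian_freeFlow_le (x : PhaseSpace N) (t : ℝ) :
    (pinnedChain ω₂ lam β γ).hamiltonian N ((pinnedChain ω₂ lam β γ).chainFlow N x 0 t) ≤
      (pinnedChain ω₂ lam β γ).hamiltonian N x := by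
  rcases le_or_gt t 0 with ht | ht
  · rw [pinnedChain_freeFlow_of_nonpos N x ht]
  · rw [pinnedChain_hamiltonian_freeFlow_eq hω hl hβ hγ N x ht.le]
    linarith [pinnedChain_dissipation_nonneg hω hl hβ hγ N x (η := 0) continuous_zero ht.le]

/-- The energy along the undriven flow is nonincreasing in time (on all of `ℝ`, the flow being
clamped on `(-∞, 0]`). [folklore] -/
theorem pinnedChain_antitone_hamiltonian_freeFlow (x : PhaseSpace N) :
    Antitone fun t => (pinnedChain ω₂ lam β γ).hamiltonian N ((pinnedChain ω₂ lam β γ).chainFlow N x 0 t) := by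
  intro a b hab
  simp only
  rcases le_or_gt a 0 with ha | ha
  · rw [pinnedChain_freeFlow_of_nonpos N x ha]
    exact pinnedChain_hamiltonian_freeFlow_le hω hl hβ hγ N x b
  · -- `0 < a ≤ b`: `φ_b = φ_{b-a} ∘ φ_a`
    have h := pinnedChain_freeFlow_add hω hl hβ hγ N x ha.le (sub_nonneg.2 hab)
    rw [add_sub_cancel] at h
    rw [h]
    exact pinnedChain_hamiltonian_freeFlow_le hω hl hβ hγ N _ _

/-- The energy along the undriven flow converges as `t → ∞`. [folklore] -/
theorem pinnedChain_exists_tendsto_hamiltonian_freeFlow (x : PhaseSpace N) :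
    ∃ Einf : ℝ, Tendsto (fun t => (pinnedChain ω₂ lam β γ).hamiltonian N
      ((pinnedChain ω₂ lam β γ).chainFlow N x 0 t)) atTop (𝓝 Einf) := by
  refine ⟨_, tendsto_atTop_ciInf (pinnedChain_antitone_hamiltonian_freeFlow hω hl hβ hγ N x) ⟨0, ?_⟩⟩
  rintro _ ⟨t, rfl⟩
  exact pinnedChain_hamiltonian_nonneg hω.le hl hβ γ N _

/-- The orbit of the undriven flow stays in the compact sublevel set `{H ≤ H(x)}`. [folklore] -/
theorem pinnedChain_freeFlow_mem_sublevel (x : PhaseSpace N) (t : ℝ) :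
    (pinnedChain ω₂ lam β γ).chainFlow N x 0 t ∈
      {y : PhaseSpace N | (pinnedChain ω₂ lam β γ).hamiltonian N y ≤ (pinnedChain ω₂ lam β γ).hamiltonian N x} :=
  pinnedChain_hamiltonian_freeFlow_le hω hl hβ hγ N x t

/-! ### Constant energy along the orbit of a cluster point -/

/-- **At a cluster point of the orbit the energy is stationary**: if `w` is a cluster point of
`t ↦ φ_t(x)` at `+∞` then `H(φ_s w) = H(w)` for every `s ≥ 0` (both equal the limit of
`H(φ_t x)`: `y ↦ H(φ_s y)` is continuous and `H(φ_s(φ_t x)) = H(φ_{t+s} x)`). [folklore] -/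
theorem pinnedChain_hamiltonian_freeFlow_eq_of_mapClusterPt (x : PhaseSpace N) {w : PhaseSpace N}
    (hw : MapClusterPt w atTop fun t => (pinnedChain ω₂ lam β γ).chainFlow N x 0 t) {s : ℝ}
    (hs : 0 ≤ s) :
    (pinnedChain ω₂ lam β γ).hamiltonian N ((pinnedChain ω₂ lam β γ).chainFlow N w 0 s) =
      (pinnedChain ω₂ lam β γ).hamiltonian N w := by
  set P := pinnedChain ω₂ lam β γ with hP
  obtain ⟨Einf, hE⟩ := pinnedChain_exists_tendsto_hamiltonian_freeFlow hω hl hβ hγ N x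
  -- `H(φ_r y)` is continuous in `y` for every `r`
  have hcont : ∀ r : ℝ, Continuous fun y => P.hamiltonian N (P.chainFlow N y 0 r) := fun r =>
    (pinnedChain_continuous_hamiltonian ω₂ lam β γ N).comp
      (pinnedChain_continuous_chainFlow_left hω hl hβ hγ N (η := 0) continuous_zero r)
  -- both `H(φ_s w)` and `H(w) = H(φ_0 w)` are the limit `Einf`
  have hval : ∀ r : ℝ, 0 ≤ r → P.hamiltonian N (P.chainFlow N w 0 r) = Einf := by
    intro r hr
    have hcl : MapClusterPt (P.hamiltonian N (P.chainFlow N w 0 r)) atTop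
        ((fun y => P.hamiltonian N (P.chainFlow N y 0 r)) ∘ fun t => P.chainFlow N x 0 t) :=
      MapClusterPt.continuousAt_comp (f := fun y => P.hamiltonian N (P.chainFlow N y 0 r))
        (hcont r).continuousAt hw
    have heq : ((fun y => P.hamiltonian N (P.chainFlow N y 0 r)) ∘ fun t => P.chainFlow N x 0 t) =ᶠ[atTop]
        fun t => P.hamiltonian N (P.chainFlow N x 0 (t + r)) := by
      filter_upwards [eventually_ge_atTop 0] with t ht
      simp only [Function.comp_apply]
      rw [pinnedChain_freeFlow_add hω hl hβ hγ N x ht hr]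
    have hlim : Tendsto (fun t => P.hamiltonian N (P.chainFlow N x 0 (t + r))) atTop (𝓝 Einf) :=
      hE.comp (tendsto_atTop_add_const_right atTop r tendsto_id)
    -- a cluster value of a convergent function is its limit (Hausdorff)
    exact t2_iff_nhds.1 inferInstance (((hcl.congrFun heq).clusterPt).mono hlim)
  have h0 := hval 0 le_rfl
  rw [pinnedChain_freeFlow_zero N w] at h0
  rw [hval s hs, h0]

/-- At a cluster point of the orbit the dissipation vanishes along the flow: `Γ_s(w) = 0` for
`s ≥ 0`. [folklore] -/
theorem pinnedChain_dissipation_eq_zero_of_mapClusterPt (x : PhaseSpace N) {w : PhaseSpace N}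
    (hw : MapClusterPt w atTop fun t => (pinnedChain ω₂ lam β γ).chainFlow N x 0 t) {s : ℝ}
    (hs : 0 ≤ s) : (pinnedChain ω₂ lam β γ).dissipation N w 0 s = 0 := by
  have h1 := pinnedChain_hamiltonian_freeFlow_eq_of_mapClusterPt hω hl hβ hγ N x hw hs
  have h2 := pinnedChain_hamiltonian_freeFlow_eq hω hl hβ hγ N w hs
  linarith

end Free

/-! ### Vanishing dissipation forces the end momenta to vanish -/

section Dissipation

variable {ω₂ lam β γ : ℝ} (hω : 0 < ω₂) (hl : 0 ≤ lam) (hβ : 0 ≤ β) (hγ : 0 < γ) (N : ℕ)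
include hω hl hβ hγ

/-- **If the dissipation vanishes along the undriven flow then so do the momenta of the bath
sites**: `Γ_s(w) = 0` for all `s ≥ 0` and `γ > 0` force `w_i p_i(s)² = 0`, in particular
`p_i(s) = 0` at every site `i` with `w_i ≠ 0` (`i = 0` and `i = N-1`). [folklore] -/
theorem pinnedChain_momentum_eq_zero_of_dissipation_eq_zero (w : PhaseSpace N)
    (h : ∀ s, 0 ≤ s → (pinnedChain ω₂ lam β γ).dissipation N w 0 s = 0) (i : Fin N)
    (hi : bathWeight N i ≠ 0) :
    ∀ s, 0 ≤ s → ((pinnedChain ω₂ lam β γ).chainFlow N w 0 s).2 i = 0 := by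
  set P := pinnedChain ω₂ lam β γ with hP
  set D : ℝ → ℝ := fun r => ∑ j, bathWeight N j * (P.chainFlow N w 0 r).2 j ^ 2 with hD
  have hzc := pinnedChain_continuous_chainFlow hω hl hβ hγ.le N w (η := 0) continuous_zero
  have hDc : Continuous D := by
    refine continuous_finsetSum _ fun j _ => ?_
    exact continuous_const.mul (((continuous_apply j).comp (continuous_snd.comp hzc)).pow 2)
  have hint : ∀ t, 0 ≤ t → ∫ s in (0 : ℝ)..t, D s = 0 := by
    intro t ht
    have h1 := h t ht
    simp only [OscillatorChain.dissipation] at h1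
    rcases mul_eq_zero.1 h1 with h2 | h2
    · exact absurd h2 (by rw [hP]; exact hγ.ne')
    · exact h2
  have hD0 := eq_zero_of_intervalIntegral_eq_zero hDc hint
  intro s hs
  have hsum : ∑ j, bathWeight N j * (P.chainFlow N w 0 s).2 j ^ 2 = 0 := hD0 s hs
  have hterm := (Finset.sum_eq_zero_iff_of_nonneg fun j _ =>
    mul_nonneg (bathWeight_nonneg N j) (sq_nonneg _)).1 hsum i (Finset.mem_univ i)
  rcases mul_eq_zero.1 hterm with h3 | h3
  · exact absurd h3 hi
  · exact pow_eq_zero_iff (n := 2) two_ne_zero |>.1 h3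

omit hω hl hβ hγ in
/-- The last site carries a bath: `w_{N-1} ≠ 0`. [folklore] -/
theorem bathWeight_last_ne_zero (hN : 0 < N) : bathWeight N ⟨N - 1, by omega⟩ ≠ 0 := by
  unfold bathWeight
  have h1 : (0 : ℝ) ≤ if (⟨N - 1, by omega⟩ : Fin N).val = 0 then 1 else 0 := by
    split_ifs <;> norm_num
  have h2 : (if (⟨N - 1, by omega⟩ : Fin N).val = N - 1 then (1 : ℝ) else 0) = 1 := by simp
  rw [h2]
  linarith

end Dissipation

/-! ### Rigidity: a motionless right end freezes the whole chain at the origin -/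

/-- **Virial identity for the force**: `∑_i q_i ∂_iΦ(q) = ∑_i q_i U'(q_i) + ∑_{bonds} V'(Δ) Δ`
(`Δ = q_{k+1} - q_k`; the bond terms of `dPotential` regroup by action–reaction). [folklore] -/
theorem OscillatorChain.sum_mul_dPotential (P : OscillatorChain) (N : ℕ) (q : Fin N → ℝ) :
    ∑ i, q i * P.dPotential N i q =
      ∑ i, q i * deriv P.U (q i) +
        ∑ k : Fin N, ∑ l : Fin N,
          if l.val = k.val + 1 then deriv P.V (q l - q k) * (q l - q k) else 0 := by
  simp only [OscillatorChain.dPotential, mul_add, Finset.sum_add_distrib]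
  congr 1
  have h1 : ∀ i : Fin N, q i * ∑ k : Fin N, ∑ l : Fin N, (if l.val = k.val + 1 then
      deriv P.V (q l - q k) * ((if l = i then 1 else 0) - (if k = i then 1 else 0)) else 0) =
      ∑ k : Fin N, ∑ l : Fin N, (if l.val = k.val + 1 then
        deriv P.V (q l - q k) * (q i * ((if l = i then 1 else 0) - (if k = i then 1 else 0))) else 0) := by
    intro i
    rw [Finset.mul_sum]
    refine Finset.sum_congr rfl fun k _ => ?_
    rw [Finset.mul_sum]
    refine Finset.sum_congr rfl fun l _ => ?_
    split_ifs <;> ring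
  simp_rw [h1]
  rw [Finset.sum_comm]
  refine Finset.sum_congr rfl fun k _ => ?_
  rw [Finset.sum_comm]
  refine Finset.sum_congr rfl fun l _ => ?_
  by_cases h : l.val = k.val + 1
  · simp only [h, if_true]
    rw [← Finset.mul_sum]
    congr 1
    simp [mul_sub, Finset.sum_sub_distrib, mul_ite, Finset.sum_ite_eq]
  · simp [h]

/-- **The only critical point of the pinned potential is the origin** (`ω₂ > 0`, `lam, β ≥ 0`):
`∂_iΦ(q) = 0` for all `i` forces `q = 0`, since `∑ q_i ∂_iΦ(q) ≥ ω₂ ∑ q_i²` (`qU'(q) =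
ω₂q² + lam q⁴`, `rV'(r) = r² + βr⁴ ≥ 0`). [folklore] -/
theorem pinnedChain_eq_zero_of_dPotential_eq_zero {ω₂ lam β : ℝ} (hω : 0 < ω₂) (hl : 0 ≤ lam)
    (hβ : 0 ≤ β) (γ : ℝ) (N : ℕ) (q : Fin N → ℝ)
    (h : ∀ i, (pinnedChain ω₂ lam β γ).dPotential N i q = 0) : q = 0 := by
  have hsum : ∑ i, q i * (pinnedChain ω₂ lam β γ).dPotential N i q = 0 := by simp [h]
  rw [OscillatorChain.sum_mul_dPotential] at hsum
  simp only [pinnedChain_deriv_U, pinnedChain_deriv_V] at hsum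
  have h1 : ω₂ * ∑ i, q i ^ 2 ≤ ∑ i, q i * (ω₂ * q i + lam * q i ^ 3) := by
    rw [Finset.mul_sum]
    refine Finset.sum_le_sum fun i _ => ?_
    have : 0 ≤ lam * q i ^ 4 := mul_nonneg hl (by positivity)
    nlinarith
  have h2 : 0 ≤ ∑ k : Fin N, ∑ l : Fin N,
      (if l.val = k.val + 1 then ((q l - q k) + β * (q l - q k) ^ 3) * (q l - q k) else 0) := by
    refine Finset.sum_nonneg fun k _ => Finset.sum_nonneg fun l _ => ?_
    split_ifs
    · have : 0 ≤ β * (q l - q k) ^ 4 := mul_nonneg hβ (by positivity)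
      nlinarith [sq_nonneg (q l - q k)]
    · exact le_rfl
  have h3 : ∑ i, q i ^ 2 ≤ 0 := by
    by_contra hcon
    push Not at hcon
    have : 0 < ω₂ * ∑ i, q i ^ 2 := mul_pos hω hcon
    linarith
  have h4 := (Finset.sum_eq_zero_iff_of_nonneg fun i _ => sq_nonneg (q i)).1
    (le_antisymm h3 (Finset.sum_nonneg fun i _ => sq_nonneg (q i)))
  funext i
  exact pow_eq_zero_iff two_ne_zero |>.1 (h4 i (Finset.mem_univ i))

/-- The force at an interior-or-right site `i+1` in closed form:
`∂_{i+1}Φ(q) = U'(q_{i+1}) + V'(q_{i+1} - q_i) - [i+2 < N] V'(q_{i+2} - q_{i+1})`. [folklore] -/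
theorem OscillatorChain.dPotential_succ_eq (P : OscillatorChain) (N : ℕ) (i : Fin N)
    (hi : i.val + 1 < N) (q : Fin N → ℝ) :
    P.dPotential N ⟨i.val + 1, hi⟩ q =
      deriv P.U (q ⟨i.val + 1, hi⟩) + deriv P.V (q ⟨i.val + 1, hi⟩ - q i) -
        (if h : i.val + 1 + 1 < N then deriv P.V (q ⟨i.val + 1 + 1, h⟩ - q ⟨i.val + 1, hi⟩) else 0) := by
  rw [P.dPotential_eq_closed]
  have h1 : (0 : ℕ) < (⟨i.val + 1, hi⟩ : Fin N).val := Nat.succ_pos _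
  rw [dif_pos h1]
  have h2 : (⟨(⟨i.val + 1, hi⟩ : Fin N).val - 1, by simp only [Nat.add_sub_cancel]; omega⟩ : Fin N) = i :=
    Fin.ext (by simp)
  simp only [h2]

/-- `V' = r + βr³` is injective for `β ≥ 0` (strictly increasing). [folklore] -/
theorem pinnedChain_deriv_V_injective (ω₂ lam : ℝ) {β : ℝ} (hβ : 0 ≤ β) (γ : ℝ) :
    Function.Injective (deriv (pinnedChain ω₂ lam β γ).V) := by
  have heq : deriv (pinnedChain ω₂ lam β γ).V = fun r => r + β * r ^ 3 :=
    funext fun r => pinnedChain_deriv_V ω₂ lam β γ r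
  rw [heq]
  refine StrictMono.injective (strictMono_id.add_monotone ?_)
  exact ((Odd.strictMono_pow (by decide : Odd 3)).monotone).const_mul hβ

section Rigidity

variable {ω₂ lam β γ : ℝ} (hω : 0 < ω₂) (hl : 0 ≤ lam) (hβ : 0 ≤ β) (hγ : 0 ≤ γ) (N : ℕ)
include hω hl hβ hγ

omit hω hl hβ hγ in
/-- The drift of the pinned chain in closed form: `Y(q, p) = (p, -∂Φ(q) - γ w p)`. [folklore] -/
theorem pinnedChain_drift_apply (x : PhaseSpace N) :
    (pinnedChain ω₂ lam β γ).drift N x =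
      (x.2, fun i => -(pinnedChain ω₂ lam β γ).dPotential N i x.1 - γ * bathWeight N i * x.2 i) := by
  have h := (pinnedChain ω₂ lam β γ).drift_eq
    ((pinnedChain_contDiff_U ω₂ lam β γ (n := 1)).differentiable one_ne_zero)
    ((pinnedChain_contDiff_V ω₂ lam β γ (n := 1)).differentiable one_ne_zero) N
  rw [h]
  rfl

/-- **Position components of the integral equation**: `q_i(t) = q_i(0) + ∫₀ᵗ p_i`. [folklore] -/
theorem pinnedChain_freeFlow_fst_eq (x : PhaseSpace N) (i : Fin N) {t : ℝ} (ht : 0 ≤ t) :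
    ((pinnedChain ω₂ lam β γ).chainFlow N x 0 t).1 i =
      x.1 i + ∫ s in (0 : ℝ)..t, ((pinnedChain ω₂ lam β γ).chainFlow N x 0 s).2 i := by
  set P := pinnedChain ω₂ lam β γ with hP
  have hzc : Continuous (P.chainFlow N x 0) :=
    pinnedChain_continuous_chainFlow hω hl hβ hγ N x (η := 0) continuous_zero
  have hYc : Continuous (P.drift N) := (pinnedChain_contDiff_drift ω₂ lam β γ N (n := 0)).continuous
  have hF : IntervalIntegrable (fun s => P.drift N (P.chainFlow N x 0 s)) volume 0 t :=
    (hYc.comp hzc).intervalIntegrable 0 t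
  have h := pinnedChain_freeFlow_eq_integral hω hl hβ hγ N x ht
  have hcomp := ((ContinuousLinearMap.proj (R := ℝ) i).comp
    (ContinuousLinearMap.fst ℝ (Fin N → ℝ) (Fin N → ℝ))).intervalIntegral_comp_comm hF
  have h1 : ((P.chainFlow N x 0 t).1) i =
      x.1 i + ((∫ s in (0 : ℝ)..t, P.drift N (P.chainFlow N x 0 s)).1) i := by
    rw [h]
    rfl
  rw [h1]
  congr 1
  simp only [ContinuousLinearMap.coe_comp, ContinuousLinearMap.coe_fst', Function.comp_apply,
    ContinuousLinearMap.proj_apply] at hcomp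
  rw [← hcomp]
  refine intervalIntegral.integral_congr fun s _ => ?_
  rw [pinnedChain_drift_apply N]

/-- **Momentum components of the integral equation**:
`p_i(t) = p_i(0) + ∫₀ᵗ (-∂_iΦ(q) - γ w_i p_i)`. [folklore] -/
theorem pinnedChain_freeFlow_snd_eq (x : PhaseSpace N) (i : Fin N) {t : ℝ} (ht : 0 ≤ t) :
    ((pinnedChain ω₂ lam β γ).chainFlow N x 0 t).2 i =
      x.2 i + ∫ s in (0 : ℝ)..t,
        (-(pinnedChain ω₂ lam β γ).dPotential N i ((pinnedChain ω₂ lam β γ).chainFlow N x 0 s).1 -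
          γ * bathWeight N i * ((pinnedChain ω₂ lam β γ).chainFlow N x 0 s).2 i) := by
  set P := pinnedChain ω₂ lam β γ with hP
  have hzc : Continuous (P.chainFlow N x 0) :=
    pinnedChain_continuous_chainFlow hω hl hβ hγ N x (η := 0) continuous_zero
  have hYc : Continuous (P.drift N) := (pinnedChain_contDiff_drift ω₂ lam β γ N (n := 0)).continuous
  have hF : IntervalIntegrable (fun s => P.drift N (P.chainFlow N x 0 s)) volume 0 t :=
    (hYc.comp hzc).intervalIntegrable 0 t
  have h := pinnedChain_freeFlow_eq_integral hω hl hβ hγ N x ht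
  have hcomp := ((ContinuousLinearMap.proj (R := ℝ) i).comp
    (ContinuousLinearMap.snd ℝ (Fin N → ℝ) (Fin N → ℝ))).intervalIntegral_comp_comm hF
  have h1 : ((P.chainFlow N x 0 t).2) i =
      x.2 i + ((∫ s in (0 : ℝ)..t, P.drift N (P.chainFlow N x 0 s)).2) i := by
    rw [h]
    rfl
  rw [h1]
  congr 1
  simp only [ContinuousLinearMap.coe_comp, ContinuousLinearMap.coe_snd', Function.comp_apply,
    ContinuousLinearMap.proj_apply] at hcomp
  rw [← hcomp]
  refine intervalIntegral.integral_congr fun s _ => ?_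
  rw [pinnedChain_drift_apply N]

/-- Along the undriven flow, a momentum that vanishes identically freezes its position:
`p_i ≡ 0 ⟹ q_i ≡ q_i(0)`. [folklore] -/
theorem pinnedChain_freeFlow_fst_const_of_snd_eq_zero (x : PhaseSpace N) (i : Fin N)
    (hp : ∀ t, 0 ≤ t → ((pinnedChain ω₂ lam β γ).chainFlow N x 0 t).2 i = 0) :
    ∀ t, 0 ≤ t → ((pinnedChain ω₂ lam β γ).chainFlow N x 0 t).1 i = x.1 i := by
  intro t ht
  rw [pinnedChain_freeFlow_fst_eq hω hl hβ hγ N x i ht]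
  have : ∫ s in (0 : ℝ)..t, ((pinnedChain ω₂ lam β γ).chainFlow N x 0 s).2 i = ∫ s in (0 : ℝ)..t, (0 : ℝ) := by
    refine intervalIntegral.integral_congr fun s hs => ?_
    rw [uIcc_of_le ht] at hs
    exact hp s hs.1
  rw [this]
  simp

/-- Along the undriven flow, a momentum that vanishes identically makes the force on its site
vanish: `p_i ≡ 0 ⟹ ∂_iΦ(q(t)) = 0`. [folklore] -/
theorem pinnedChain_dPotential_eq_zero_of_snd_eq_zero (x : PhaseSpace N) (i : Fin N)
    (hp : ∀ t, 0 ≤ t → ((pinnedChain ω₂ lam β γ).chainFlow N x 0 t).2 i = 0) :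
    ∀ t, 0 ≤ t → (pinnedChain ω₂ lam β γ).dPotential N i ((pinnedChain ω₂ lam β γ).chainFlow N x 0 t).1 = 0 := by
  set P := pinnedChain ω₂ lam β γ with hP
  have hzc : Continuous (P.chainFlow N x 0) :=
    pinnedChain_continuous_chainFlow hω hl hβ hγ N x (η := 0) continuous_zero
  have hFc : Continuous fun s => P.dPotential N i (P.chainFlow N x 0 s).1 :=
    ((pinnedChain ω₂ lam β γ).contDiff_dPotential (pinnedChain_contDiff_U ω₂ lam β γ)
      (pinnedChain_contDiff_V ω₂ lam β γ) N i).continuous.comp (continuous_fst.comp hzc)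
  have hx0 : x.2 i = 0 := by
    have h0 := hp 0 le_rfl
    rwa [pinnedChain_freeFlow_zero N x] at h0
  refine eq_zero_of_intervalIntegral_eq_zero hFc fun t ht => ?_
  have h1 := pinnedChain_freeFlow_snd_eq hω hl hβ hγ N x i ht
  rw [hp t ht, hx0] at h1
  have h2 : ∫ s in (0 : ℝ)..t, (-P.dPotential N i (P.chainFlow N x 0 s).1 -
      γ * bathWeight N i * (P.chainFlow N x 0 s).2 i) =
      ∫ s in (0 : ℝ)..t, -P.dPotential N i (P.chainFlow N x 0 s).1 := by
    refine intervalIntegral.integral_congr fun s hs => ?_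
    rw [uIcc_of_le ht] at hs
    simp only [hP] at hp ⊢
    rw [hp s hs.1]
    ring
  rw [h2, intervalIntegral.integral_neg] at h1
  linarith

/-- **Rigidity**: if along the undriven flow started at `w` the momentum of the last site vanishes
for all times, then `w = 0` (`N ≥ 1`, `ω₂ > 0`, `lam, β, γ ≥ 0`). Peeling from the right: by
induction every site `i ≥ N - k` has `p_i ≡ 0` (so `q_i` frozen); for the next site, the
vanishing force at site `i+1` pins `V'(q_{i+1} - q_i(t))` to a constant, so `q_i` is frozen
(`V'` injective) and `p_i = q̇_i ≡ 0`. At the end `w` is a critical point of `Φ` with `p = 0`,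
hence `w = 0`. [cite: CuneoEckmannHairerReyBellet2018, Prop 3.3] -/
theorem pinnedChain_eq_zero_of_momentum_last_eq_zero (hN : 0 < N) (w : PhaseSpace N)
    (h : ∀ t, 0 ≤ t → ((pinnedChain ω₂ lam β γ).chainFlow N w 0 t).2 ⟨N - 1, by omega⟩ = 0) :
    w = 0 := by
  set P := pinnedChain ω₂ lam β γ with hP
  have hzc : Continuous (P.chainFlow N w 0) :=
    pinnedChain_continuous_chainFlow hω hl hβ hγ N w (η := 0) continuous_zero
  have hz0 : P.chainFlow N w 0 0 = w := pinnedChain_freeFlow_zero N w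
  have hinj := pinnedChain_deriv_V_injective ω₂ lam hβ γ
  -- peeling induction on the number `k` of frozen sites from the right
  have hpeel : ∀ k, k ≤ N → ∀ i : Fin N, N - k ≤ i.val →
      ∀ t, 0 ≤ t → (P.chainFlow N w 0 t).2 i = 0 := by
    intro k
    induction k with
    | zero =>
      intro _ i hi
      exact absurd i.isLt (by omega)
    | succ k ih =>
      intro hk i hi
      by_cases hi' : N - k ≤ i.val
      · exact ih (by omega) i hi'
      · have hieq : i.val = N - (k + 1) := by omega
        rcases Nat.eq_zero_or_pos k with hk0 | hkpos
        · -- the last site: hypothesis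
          subst hk0
          have hiN : i = ⟨N - 1, by omega⟩ := Fin.ext (by simpa using hieq)
          intro t ht
          rw [hiN]
          exact h t ht
        · -- peel site `i` off using site `i₁ = i + 1`
          have hi₁ : i.val + 1 < N := by omega
          have hp₁ : ∀ t, 0 ≤ t → (P.chainFlow N w 0 t).2 ⟨i.val + 1, hi₁⟩ = 0 :=
            ih (by omega) ⟨i.val + 1, hi₁⟩ (by simp only; omega)
          have hq₁ := pinnedChain_freeFlow_fst_const_of_snd_eq_zero hω hl hβ hγ N w ⟨i.val + 1, hi₁⟩ hp₁
          have hF₁ := pinnedChain_dPotential_eq_zero_of_snd_eq_zero hω hl hβ hγ N w ⟨i.val + 1, hi₁⟩ hp₁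
          have hq₂ : ∀ (h2 : i.val + 1 + 1 < N) (t : ℝ), 0 ≤ t →
              (P.chainFlow N w 0 t).1 ⟨i.val + 1 + 1, h2⟩ = w.1 ⟨i.val + 1 + 1, h2⟩ := fun h2 =>
            pinnedChain_freeFlow_fst_const_of_snd_eq_zero hω hl hβ hγ N w ⟨i.val + 1 + 1, h2⟩
              (ih (by omega) ⟨i.val + 1 + 1, h2⟩ (by simp only; omega))
          -- the interaction force on the bond `(i, i+1)` is frozen
          have hV : ∀ t, 0 ≤ t →
              deriv P.V (w.1 ⟨i.val + 1, hi₁⟩ - (P.chainFlow N w 0 t).1 i) =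
                -deriv P.U (w.1 ⟨i.val + 1, hi₁⟩) +
                  (if h2 : i.val + 1 + 1 < N then
                    deriv P.V (w.1 ⟨i.val + 1 + 1, h2⟩ - w.1 ⟨i.val + 1, hi₁⟩) else 0) := by
            intro t ht
            have e := hF₁ t ht
            rw [P.dPotential_succ_eq N i hi₁, hq₁ t ht] at e
            by_cases h2 : i.val + 1 + 1 < N
            · rw [dif_pos h2, hq₂ h2 t ht] at e
              rw [dif_pos h2]
              linarith
            · rw [dif_neg h2] at e
              rw [dif_neg h2]
              linarith
          -- hence `q_i` is frozen
          have hqi : ∀ t, 0 ≤ t → (P.chainFlow N w 0 t).1 i = w.1 i := by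
            intro t ht
            have e1 := hV t ht
            have e0 := hV 0 le_rfl
            rw [hz0] at e0
            have e2 := hinj (e1.trans e0.symm)
            linarith
          -- hence `p_i ≡ 0`
          have hpc : Continuous fun s => (P.chainFlow N w 0 s).2 i :=
            (continuous_apply i).comp (continuous_snd.comp hzc)
          refine eq_zero_of_intervalIntegral_eq_zero hpc fun t ht => ?_
          have e := pinnedChain_freeFlow_fst_eq hω hl hβ hγ N w i ht
          rw [hqi t ht] at e
          linarith
  -- all momenta vanish, all forces vanish at `w`
  have hall : ∀ i : Fin N, ∀ t, 0 ≤ t → (P.chainFlow N w 0 t).2 i = 0 :=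
    fun i => hpeel N le_rfl i (by omega)
  have hp0 : w.2 = 0 := by
    funext i
    have := hall i 0 le_rfl
    rwa [hz0] at this
  have hq0 : w.1 = 0 := by
    refine pinnedChain_eq_zero_of_dPotential_eq_zero hω hl hβ γ N w.1 fun i => ?_
    have := pinnedChain_dPotential_eq_zero_of_snd_eq_zero hω hl hβ hγ N w i (hall i) 0 le_rfl
    rwa [hz0] at this
  exact Prod.ext hq0 hp0

end Rigidity

/-! ### LaSalle: the undriven chain relaxes to the origin -/

section LaSalle

variable {ω₂ lam β γ : ℝ} (hω : 0 < ω₂) (hl : 0 ≤ lam) (hβ : 0 ≤ β) (hγ : 0 < γ) {N : ℕ}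
  (hN : 0 < N)
include hω hl hβ hγ hN

/-- **LaSalle's invariance principle for the damped pinned chain**: every trajectory of the
undriven chain (`ω₂, β, γ > 0`, `lam ≥ 0`, `N ≥ 1`, friction at both ends) converges to the
unique equilibrium `0` as `t → ∞`. The orbit lies in the compact set `{H ≤ H(x)}`; if it did not
converge to `0`, it would have a cluster point `w ≠ 0`; along `φ(w)` the energy is constant
(`pinnedChain_hamiltonian_freeFlow_eq_of_mapClusterPt`), so the dissipation vanishes, so the
momentum of the last site vanishes identically, so `w = 0` by rigidity — a contradiction.
[cite: CuneoEckmannHairerReyBellet2018, Prop 3.3] -/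
theorem pinnedChain_tendsto_freeFlow_zero (x : PhaseSpace N) :
    Tendsto (fun t => (pinnedChain ω₂ lam β γ).chainFlow N x 0 t) atTop (𝓝 0) := by
  set P := pinnedChain ω₂ lam β γ with hP
  by_contra hnot
  obtain ⟨U, hU, hfreq⟩ := not_tendsto_iff_exists_frequently_notMem.1 hnot
  obtain ⟨V, hVU, hVopen, h0V⟩ := _root_.mem_nhds_iff.1 hU
  -- the compact set `K = {H ≤ H(x)} \ V` is visited frequently
  set K : Set (PhaseSpace N) := {y | P.hamiltonian N y ≤ P.hamiltonian N x} ∩ Vᶜ with hK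
  have hKc : IsCompact K :=
    (pinnedChain_isCompact_setOf_hamiltonian_le hω hl hβ γ N _).inter_right hVopen.isClosed_compl
  have hfreqK : ∃ᶠ t in atTop, P.chainFlow N x 0 t ∈ K := by
    refine (hfreq.and_eventually (Eventually.of_forall fun t =>
      pinnedChain_freeFlow_mem_sublevel hω hl hβ hγ.le N x t)).mono fun t ht => ?_
    exact ⟨ht.2, fun hV => ht.1 (hVU hV)⟩
  obtain ⟨w, hwK, hw⟩ := hKc.exists_mapClusterPt_of_frequently hfreqK
  -- along `φ(w)` the dissipation vanishes, hence so does the momentum of the last site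
  have hdis : ∀ s, 0 ≤ s → P.dissipation N w 0 s = 0 := fun s hs =>
    pinnedChain_dissipation_eq_zero_of_mapClusterPt hω hl hβ hγ.le N x hw hs
  have hlast := pinnedChain_momentum_eq_zero_of_dissipation_eq_zero hω hl hβ hγ N w hdis
    ⟨N - 1, by omega⟩ (bathWeight_last_ne_zero N hN)
  -- rigidity: `w = 0`, contradicting `w ∉ V ∋ 0`
  have hw0 : w = 0 := pinnedChain_eq_zero_of_momentum_last_eq_zero hω hl hβ hγ.le N hN w hlast
  exact hwK.2 (hw0 ▸ h0V)

end LaSalle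

end Literature.MathematicalPhysics.KineticTheory.HeatConduction
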